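import Literature.Barriers.QuantumAdvantage.PPolyOraclesLem75Circuit
import Literature.Computability.Complexity.CodeFPBudgets
import Literature.Computability.Complexity.CodeFPLists
import Literature.Computability.QuantumComplexity.OracleCoinFn
import HarnessLib

/-!
# Aaronson–Chen 2017, Lemma 7.5 (2)–(3): the period-finding oracle family, V — the block function is polynomial time

Topic `Literature/Barriers/QuantumAdvantage`; fifth file of the discharge of
`aaronsonChen2017_lem75_quantum` (`PPolyOraclesThm76.lean`). The clean block of the classical part
`V` (`PPolyOraclesLem75Circuit.lean`) computes the block function `fZ` with
`fZ ((x ++ cs) ++ vg n) = Shape.word n cs`: the `S` block values `z_s` (offset plus the weighted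
count of the raised controls, mod `2^{b_s}`) in fixed-width binary. This file writes `word` as a
functional program on codes (`CodeFP.lean`: substrings, pop-counts, bounded sums and ranges) and so
gives, for every shape, a polynomial-time `fZ` and a machine for it
(`RevClean.exists_outputsWithin_pow_of_mem_FP`), i.e. the parameters `mk sh : Params` with
`(mk sh).toShape = sh` — the programming fact `mk`/`hmk` of `Lem75Q.lem75_quantum_of`
(`PPolyOraclesLem75Quantum.lean`).

* string helpers on codes: `strSub` (substring by binary start and length), `strCount`
  (`HashBricks.popCountFn`), `natBitsC` (fixed-width digits through `encodeNat (z + 2^b)`),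
  `unPolyFst` (sums and concatenations of raw lists are folded inline, `CodeFP.foldl₀`);
* `wordF` and `wordF_eq_word`, `codeFP_wordF`;
* `mk`, `toShape_mk`.

## References

* S. Arora, B. Barak, *Computational Complexity: A Modern Approach*, CUP 2009, §1.3 (closure of
  polynomial time under composition and bounded loops) [AroraBarak2009].
* S. Aaronson, L. Chen, CCC 2017, arXiv:1612.05903, Lemma 7.5 (2), App. 13 (p. 42) [AaronsonChen2017].
-/

noncomputable section

namespace Literature.Barriers.QuantumAdvantage

namespace Lem75Q

open _root_.Computability Polynomial Literature.Computability.Complexity Literature.Computability.Complexity.Brick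
  Literature.Computability.Complexity.Plumb Literature.Computability.Complexity.CodeFP
  Literature.Computability.QuantumComplexity.RevSim Literature.Computability.QuantumComplexity.RevClean
open Literature.Computability.QuantumComplexity hiding natBits length_natBits

/-! ### Helpers on codes -/

section Helpers

/-- A polynomial of the unary first component of a pair, in unary (`Plumb.polyFn`). [cite: AroraBarak2009, §1.3] -/
theorem unPolyFst {β : Type} (Q : Polynomial ℕ) (eβ : β → List Bool) : CodeFP (pairE unE eβ) unE (fun p => Q.eval p.1) :=
  (of_fn (g := fun n : ℕ => Q.eval n) (polyFn Q) (polyFn_mem_FP Q) fun n => by rw [polyFn_apply, length_unE, unE_eq_ones]).comp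
    (fst _ _)

/-- The substring of length `m` from position `i`. [folklore] -/
def sub (w : List Bool) (i m : ℕ) : List Bool := (w.drop i).take m

/-- Dropping at least the length empties. [folklore] -/
theorem drop_min_length (w : List Bool) (i : ℕ) : w.drop (min i w.length) = w.drop i := by
  rcases le_total i w.length with h | h
  · rw [min_eq_left h]
  · rw [min_eq_right h, List.drop_of_length_le le_rfl, List.drop_of_length_le h]

/-- Taking at least the length keeps. [folklore] -/
theorem take_min_length {v w : List Bool} (hv : v.length ≤ w.length) (m : ℕ) : v.take (min m w.length) = v.take m := by
  rcases le_total m w.length with h | h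
  · rw [min_eq_left h]
  · rw [min_eq_right h, List.take_of_length_le hv, List.take_of_length_le (hv.trans h)]

/-- **Substrings by binary start and length** (`strDrop`, `strTake` through the unary length as a cap). [folklore] -/
theorem strSub : CodeFP (pairE strE (pairE natE natE)) strE (fun p => sub p.1 p.2.1 p.2.2) := by
  have hw : CodeFP (pairE strE (pairE natE natE)) strE (fun p => p.1) := fst _ _
  have hL : CodeFP (pairE strE (pairE natE natE)) unE (fun p => p.1.length) := strLength.comp hw
  have hi : CodeFP (pairE strE (pairE natE natE)) unE (fun p => min p.2.1 p.1.length) := unOfNatMin.comp (hL.pair (snd _ _).fst')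
  have hm : CodeFP (pairE strE (pairE natE natE)) unE (fun p => min p.2.2 p.1.length) := unOfNatMin.comp (hL.pair (snd _ _).snd')
  refine (strTake.comp (hm.pair (strDrop.comp (hi.pair hw)))).congr fun p => ?_
  show ((p.1 : List Bool).drop (min p.2.1 p.1.length)).take (min p.2.2 p.1.length) = sub p.1 p.2.1 p.2.2
  rw [drop_min_length, sub, take_min_length (by rw [List.length_drop]; exact Nat.sub_le _ _)]

/-- **The number of `1`s of a string** (`HashBricks.popCountFn`). [folklore] -/
theorem strCount : CodeFP strE natE (fun w => w.count true) :=
  of_fn HashBricks.popCountFn HashBricks.popCountFn_mem_FP fun w => by rw [HashBricks.popCountFn_apply]; rfl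

/-- The count of a window is the sum of its bits. [folklore] -/
theorem count_sub (w : List Bool) (i : ℕ) : ∀ m : ℕ, (sub w i m).count true = ∑ t ∈ Finset.range m, (w.getD (i + t) false).toNat := by
  intro m
  induction m with
  | zero => simp [sub]
  | succ m ih =>
    rw [Finset.sum_range_succ, ← ih, sub, sub, List.take_add_one, List.count_append]
    congr 1
    rw [List.getD_eq_getElem?_getD, ← List.getElem?_drop]
    cases (List.drop i w)[m]? with
    | none => rfl
    | some c => cases c <;> rfl

/-- A window of length one holds the bit. [folklore] -/
theorem count_sub_one (w : List Bool) (i : ℕ) : (sub w i 1).count true = (w.getD i false).toNat := by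
  rw [count_sub]; simp

/-- Fixed-width digits with a top marker: `encodeNat (z + 2^b) = natBits b z ++ [1]` for `z < 2^b`. [folklore] -/
theorem natE_add_two_pow {b z : ℕ} (hz : z < 2 ^ b) : natE (z + 2 ^ b) = natBits b z ++ [true] := by
  have hval : bitsToNat (natBits b z ++ [true]) = z + 2 ^ b := by
    rw [bitsToNat_append, bitsToNat_natBits hz, length_natBits]; simp [bitsToNat]
  rw [← hval]
  exact encodeNat_bitsToNat (Or.inr (by simp))

/-- **Fixed-width digits on codes**: `(1ᵇ, z) ↦ natBits b (z mod 2^b)`. [folklore] -/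
theorem natBitsC : CodeFP (pairE unE natE) strE (fun p => natBits p.1 (p.2 % 2 ^ p.1)) := by
  have hb : CodeFP (pairE unE natE) unE (fun p => p.1) := fst _ _
  have hp : CodeFP (pairE unE natE) natE (fun p => 2 ^ p.1) := natPow.comp ((const _ 2).pair hb)
  have hz : CodeFP (pairE unE natE) natE (fun p => p.2 % 2 ^ p.1 + 2 ^ p.1) := natAdd.comp ((natMod.comp ((snd _ _).pair hp)).pair hp)
  refine (strTake.comp (hb.pair (strOfNat.comp hz))).congr fun p => ?_
  show (natE (p.2 % 2 ^ p.1 + 2 ^ p.1)).take p.1 = _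
  rw [natE_add_two_pow (Nat.mod_lt _ (Nat.two_pow_pos _)), List.take_append_of_le_length (by simp),
    List.take_of_length_le (by simp)]

/-- List sums over `range` are `Finset` sums. [folklore] -/
theorem sum_map_range (f : ℕ → ℕ) : ∀ k : ℕ, ((List.range k).map f).sum = ∑ i ∈ Finset.range k, f i
  | 0 => rfl
  | k + 1 => by rw [List.range_succ, List.map_append, List.sum_append, sum_map_range f k, Finset.sum_range_succ]; simp

end Helpers

/-! ### The word as a program -/

section Word

variable (sh : Shape)

/-- The context of the program: `n` (unary) and the block content `cs`. [folklore] -/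
abbrev Ctx : Type := ℕ × List Bool
/-- Its code. [folklore] -/
abbrev cE : Ctx → List Bool := pairE unE strE

/-- `bM` in unary. [folklore] -/
theorem c_bMu : CodeFP cE unE (fun a : Ctx => sh.bM a.1) := (unPolyFst sh.q strE).congr fun _ => rfl
/-- `bM`. [folklore] -/
theorem c_bM : CodeFP cE natE (fun a : Ctx => sh.bM a.1) := (natOfUn.comp (c_bMu sh)).congr fun _ => rfl
/-- `Bt`. [folklore] -/
theorem c_Bt : CodeFP cE natE (fun a : Ctx => sh.Bt a.1) :=
  (natMul.comp ((const _ sh.c₀).pair (natAdd.comp ((c_bM sh).pair (const _ 1))))).congr fun _ => rfl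
/-- `wS`. [folklore] -/
theorem c_wS : CodeFP cE natE (fun a : Ctx => sh.wS a.1) :=
  (natAdd.comp ((c_bM sh).pair (natMul.comp ((c_bM sh).pair (natMul.comp ((const _ 2).pair (c_Bt sh))))))).congr fun _ => rfl
/-- `Rr`. [folklore] -/
theorem c_Rr : CodeFP cE natE (fun a : Ctx => sh.Rr a.1) := (natOfUn.comp (unPolyFst sh.R strE)).congr fun _ => rfl
/-- `S` in unary. [folklore] -/
theorem c_Su : CodeFP cE unE (fun a : Ctx => sh.S a.1) :=
  (unPolyFst ((sh.q + C 1) * sh.R) strE).congr fun a => by simp [Shape.S, Shape.bM, Shape.Rr]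

/-- The term of level `e` of block `s`: `2^e (offset bit e + number of raised controls of level e)`. [folklore] -/
def termF (a : Ctx) (s e : ℕ) : ℕ :=
  2 ^ min e (sh.bM a.1) * ((sub a.2 (s * sh.wS a.1 + e) 1).count true +
    (sub a.2 (s * sh.wS a.1 + sh.bM a.1 + e * (2 * sh.Bt a.1)) (2 * sh.Bt a.1)).count true)

/-- The block value of block `s` before reduction. [folklore] -/
def zsumF (a : Ctx) (s : ℕ) : ℕ := ((List.range (min (s / sh.Rr a.1) (sh.bM a.1))).map (termF sh a s)).sum

/-- The block value of block `s`. [folklore] -/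
def zF (a : Ctx) (s : ℕ) : ℕ := zsumF sh a s % 2 ^ min (s / sh.Rr a.1) (sh.bM a.1)

/-- **The word as a program.** [folklore] -/
def wordF (a : Ctx) : List Bool :=
  ((List.range (sh.S a.1)).map fun s => natBits (sh.bM a.1) (zF sh a s % 2 ^ sh.bM a.1)).flatten

/-- The term is computed on codes. [folklore] -/
theorem codeFP_termF : CodeFP (pairE (pairE cE natE) natE) natE (fun t => termF sh t.1.1 t.1.2 t.2) := by
  have ha : CodeFP (pairE (pairE cE natE) natE) cE (fun t => t.1.1) := (fst _ _).fst'
  have hs : CodeFP (pairE (pairE cE natE) natE) natE (fun t => t.1.2) := (fst _ _).snd'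
  have he : CodeFP (pairE (pairE cE natE) natE) natE (fun t => t.2) := snd _ _
  have hcs : CodeFP (pairE (pairE cE natE) natE) strE (fun t => t.1.1.2) := ha.snd'
  have hbM := (c_bM sh).comp ha
  have hBt := (c_Bt sh).comp ha
  have hwS := (c_wS sh).comp ha
  have heu : CodeFP (pairE (pairE cE natE) natE) unE (fun t => min t.2 (sh.bM t.1.1.1)) := unOfNatMin.comp (((c_bMu sh).comp ha).pair he)
  have hpow : CodeFP (pairE (pairE cE natE) natE) natE (fun t => 2 ^ min t.2 (sh.bM t.1.1.1)) := natPow.comp ((const _ 2).pair heu)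
  have hi1 : CodeFP (pairE (pairE cE natE) natE) natE (fun t => t.1.2 * sh.wS t.1.1.1 + t.2) :=
    natAdd.comp ((natMul.comp (hs.pair hwS)).pair he)
  have h2Bt : CodeFP (pairE (pairE cE natE) natE) natE (fun t => 2 * sh.Bt t.1.1.1) := natMul.comp ((const _ 2).pair hBt)
  have hi2 : CodeFP (pairE (pairE cE natE) natE) natE (fun t => t.1.2 * sh.wS t.1.1.1 + sh.bM t.1.1.1 + t.2 * (2 * sh.Bt t.1.1.1)) :=
    natAdd.comp ((natAdd.comp ((natMul.comp (hs.pair hwS)).pair hbM)).pair (natMul.comp (he.pair h2Bt)))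
  have hoff := strCount.comp (strSub.comp (hcs.pair (hi1.pair (const _ 1))))
  have hcnt := strCount.comp (strSub.comp (hcs.pair (hi2.pair h2Bt)))
  exact (natMul.comp (hpow.pair (natAdd.comp (hoff.pair hcnt)))).congr fun _ => rfl

/-- The block value is computed on codes. [folklore] -/
theorem codeFP_zF : CodeFP (pairE cE natE) natE (fun t => zF sh t.1 t.2) := by
  have ha : CodeFP (pairE cE natE) cE (fun t => t.1) := fst _ _
  have hs : CodeFP (pairE cE natE) natE (fun t => t.2) := snd _ _
  have hb : CodeFP (pairE cE natE) natE (fun t => t.2 / sh.Rr t.1.1) := natDiv.comp (hs.pair ((c_Rr sh).comp ha))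
  have hbu : CodeFP (pairE cE natE) unE (fun t => min (t.2 / sh.Rr t.1.1) (sh.bM t.1.1)) := unOfNatMin.comp (((c_bMu sh).comp ha).pair hb)
  have hrange : CodeFP (pairE cE natE) (rawE natE) (fun t => List.range (min (t.2 / sh.Rr t.1.1) (sh.bM t.1.1))) :=
    rangeOf.comp (((c_bMu sh).comp ha).pair hb)
  have hterms : CodeFP (pairE cE natE) (rawE natE) (fun t => (List.range (min (t.2 / sh.Rr t.1.1) (sh.bM t.1.1))).map (termF sh t.1 t.2)) :=
    ((CodeFP.map (codeFP_termF sh)).comp ((CodeFP.id _).pair hrange)).congr fun _ => rfl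
  -- sums of raw lists of numerals, folded (`CodeFP.foldl₀`; the sum's size is at most the list length plus the largest item size)
  have hfold : ∀ (l : List ℕ) (acc : ℕ), l.foldl (fun acc a => acc + a) acc = acc + l.sum := by
    intro l; induction l with
    | nil => intro acc; simp
    | cons a l ih => intro acc; rw [List.foldl_cons, ih, List.sum_cons, Nat.add_assoc]
  have hsumC : CodeFP (rawE natE) natE List.sum := by
    have h := foldl₀ (step := fun (a acc : ℕ) => acc + a) (b₀ := 0) (natAdd.comp ((snd _ _).pair (fst _ _))) (2 * X)
      (fun l₁ l₂ => by
        rw [hfold, Nat.zero_add, length_natE, eval_mul, eval_ofNat, eval_X]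
        have hM : ∀ x ∈ l₁, Nat.size x ≤ (rawE natE (l₁ ++ l₂)).length := fun x hx => by
          have h := length_item_le_length_rawE natE (List.mem_append_left l₂ hx)
          rw [length_natE] at h
          omega
        refine (size_sum_le hM).trans ?_
        have : l₁.length ≤ (rawE natE (l₁ ++ l₂)).length :=
          (List.sublist_append_left l₁ l₂).length_le.trans (length_le_length_rawE _ _)
        omega)
    exact h.congr fun l => by rw [hfold, Nat.zero_add]
  have hsum : CodeFP (pairE cE natE) natE (fun t => zsumF sh t.1 t.2) := (hsumC.comp hterms).congr fun _ => rfl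
  exact (natMod.comp (hsum.pair (natPow.comp ((const _ 2).pair hbu)))).congr fun _ => rfl

/-- **The word is computed on codes.** [cite: AroraBarak2009, §1.3] -/
theorem codeFP_wordF : CodeFP cE strE (wordF sh) := by
  have hbits : CodeFP (pairE cE natE) strE (fun t => natBits (sh.bM t.1.1) (zF sh t.1 t.2 % 2 ^ sh.bM t.1.1)) :=
    natBitsC.comp (((c_bMu sh).comp (fst _ _)).pair (codeFP_zF sh))
  have hlist : CodeFP cE (rawE strE) (fun a => (List.range (sh.S a.1)).map fun s => natBits (sh.bM a.1) (zF sh a s % 2 ^ sh.bM a.1)) :=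
    ((CodeFP.map hbits).comp ((CodeFP.id _).pair (urange.comp (c_Su sh)))).congr fun _ => rfl
  -- concatenation of a raw list of strings, folded (`CodeFP.foldl₀`; the output is no longer than the input code)
  have hfold : ∀ (l : List (List Bool)) (acc : List Bool), l.foldl (fun acc a => acc ++ a) acc = acc ++ l.flatten := by
    intro l; induction l with
    | nil => intro acc; simp
    | cons a l ih => intro acc; rw [List.foldl_cons, ih, List.flatten_cons, List.append_assoc]
  have hcat : CodeFP (rawE strE) strE List.flatten := by
    have h := foldl₀ (step := fun (a acc : List Bool) => acc ++ a) (b₀ := []) (strAppend.comp ((snd _ _).pair (fst _ _))) X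
      (fun l₁ l₂ => by
        rw [hfold, List.nil_append, eval_X, rawE_append, List.length_append]
        refine le_trans ?_ (Nat.le_add_right _ _)
        show l₁.flatten.length ≤ (rawE strE l₁).length
        rw [length_rawE, List.length_flatten]
        exact List.sum_le_sum (fun a _ => by simp only [strE, id]; omega))
    exact h.congr fun l => by rw [hfold, List.nil_append]
  exact (hcat.comp hlist).congr fun _ => rfl

/-- **The program computes the word.** [folklore] -/
theorem wordF_eq_word (n : ℕ) (cs : List Bool) : wordF sh (n, cs) = sh.word n cs := by
  unfold wordF Shape.word
  dsimp only
  rw [← List.flatMap_def]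
  refine List.flatMap_congr fun s hs => ?_
  rw [List.mem_range] at hs
  have hb : sh.bOf n s ≤ sh.bM n := sh.bOf_le n hs
  have hbmin : min (s / sh.Rr n) (sh.bM n) = sh.bOf n s := min_eq_left hb
  have hz : zF sh (n, cs) s < 2 ^ sh.bM n := by
    unfold zF
    dsimp only
    exact lt_of_lt_of_le (Nat.mod_lt _ (Nat.two_pow_pos _)) (Nat.pow_le_pow_right (by norm_num) (by rw [hbmin]; exact hb))
  rw [Nat.mod_eq_of_lt hz]
  congr 1
  -- the block value
  unfold zF zsumF Shape.zOf
  dsimp only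
  rw [hbmin, sum_map_range]
  congr 1
  rw [← Finset.sum_add_distrib]
  refine Finset.sum_congr rfl fun e he => ?_
  rw [Finset.mem_range] at he
  unfold termF
  dsimp only
  rw [min_eq_left (by unfold Shape.bOf at hb he; omega), count_sub_one, count_sub]
  simp only [Shape.cOff, Shape.cCtl, Nat.mul_add, Finset.mul_sum]
  refine congrArg₂ (· + ·) (by ring) (Finset.sum_congr rfl fun t _ => ?_)
  ring_nf

end Word

/-! ### The parameters of a shape -/

section Mk

variable (sh : Shape)

/-- Cutting `⟨1ⁿ, cs⟩` out of the block content `(x ++ cs) ++ vg n`. [folklore] -/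
def cutF : List Bool → List Bool := fanoutFn CWrap.nUF (dropFn ∘ fanoutFn CWrap.nUF CWrap.dF)

/-- `cutF ∈ FP`. [folklore] -/
theorem cutF_mem_FP : cutF ∈ FP :=
  fanoutFn_mem_FP CWrap.nUF_mem_FP (comp_mem_FP dropFn_mem_FP (fanoutFn_mem_FP CWrap.nUF_mem_FP CWrap.dF_mem_FP))

/-- `cutF` cuts correctly. [folklore] -/
theorem cutF_apply {n : ℕ} (x cs : List Bool) (hx : x.length = n) : cutF ((x ++ cs) ++ CWrap.vg n) = boolPair (unE n) cs := by
  simp only [cutF, fanoutFn_apply, Function.comp_apply, OCoin.nUF_append_vg, OCoin.dF_append_vg, dropFn_boolPair,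
    List.length_replicate, unE_eq_ones, ones]
  rw [List.drop_append_of_le_length (by omega), List.drop_of_length_le (by omega), List.nil_append]

/-- **A polynomial-time block function for the shape.** [cite: AroraBarak2009, §1.3] -/
theorem exists_fZ : ∃ fZ : List Bool → List Bool, fZ ∈ FP ∧
    ∀ (n : ℕ) (x cs : List Bool), x.length = n → cs.length = sh.K n → fZ ((x ++ cs) ++ CWrap.vg n) = sh.word n cs := by
  obtain ⟨f, hf, hfw⟩ := codeFP_wordF sh
  refine ⟨f ∘ cutF, comp_mem_FP hf cutF_mem_FP, fun n x cs hx _ => ?_⟩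
  rw [Function.comp_apply, cutF_apply x cs hx, ← wordF_eq_word]
  exact hfw (n, cs)

/-- **The parameters of a shape**: its polynomial-time block function and a machine computing it
within a power time bound (`RevClean.exists_outputsWithin_pow_of_mem_FP`) — the programming fact
`mk`/`hmk` of `lem75_quantum_of`. [cite: AroraBarak2009, §1.3] [cite: AaronsonChen2017, Lemma 7.5 (2)] -/
def mk : Params where
  toShape := sh
  fZ := Classical.choose (exists_fZ sh)
  fZ_apply := (Classical.choose_spec (exists_fZ sh)).2
  e := Classical.choose (exists_outputsWithin_pow_of_mem_FP (Classical.choose_spec (exists_fZ sh)).1)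
  Mtm := Classical.choose (Classical.choose_spec (exists_outputsWithin_pow_of_mem_FP (Classical.choose_spec (exists_fZ sh)).1))
  hM := Classical.choose_spec (Classical.choose_spec (exists_outputsWithin_pow_of_mem_FP (Classical.choose_spec (exists_fZ sh)).1))

/-- The shape of the parameters. [folklore] -/
@[simp] theorem toShape_mk : (mk sh).toShape = sh := rfl

end Mk

end Lem75Q

end Literature.Barriers.QuantumAdvantage

end
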